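import Summits.QuantumFields.BalabanUV.Beta.TentQuasiReconstruction1DEdges
import Literature.MathematicalPhysics.QuantumFieldTheory.Balaban1983to89.B5Prop11Lower

/-!
# Beta / TentQuasiReconstructionLaplacian — the free massive Laplacian A = μ·1 + Σ_i D_iᴴD_i on the torus
# (ℤ/m × Fin n)^ν as a complex matrix: D_i the forward difference along the cyclic successor of axis i; A is Hermitian,
# `g*Ag = μ‖g‖² + Σ_i ‖D_ig‖²`, hence `Re`-positive and a unit for μ > 0 (unit `b2b-balaban-beta-d4-p2`, GEN 5, MODEL crew;
# the operator of the E-I3 instance `TentQuasiReconstructionTorus`)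

HONEST FRAMING: discharging `BetaPertH` makes Bałaban's UV stability UNCONDITIONAL — NOT the continuum limit, NOT the
Clay problem.  HONEST DEPENDENCY (verbatim): «continuum YM on T⁴ ⇐ BetaPertH ∧ nine spine estimates (0/9 proved);
BetaPertH ⇐ (D1) ∧ (D4) ∧ CAP+tail; G-an2-4 gates asym, D1 and NE2/3/4.»  THIS MODULE DISCHARGES NOTHING of `BetaPertH`,
asserts NOTHING printed and cites nothing as a fact (ABSOLUTE RULE): [folklore] finite-dimensional linear algebra (MODEL).
CONTENT: `Site`, `Blk`, `shiftMat`, `dMat`, `lapA`, `lapA_isHermitian`, `form_lapA`, `re_form_lapA`, `lapA_re_nonneg`,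
`eq_zero_of_nsq_eq_zero`, `lapA_isUnit`.  NOT BetaPertH, NOT continuum, NOT Clay.
-/

namespace Summit.QuantumFields.BalabanUV.Beta.TentQuasiReconstructionLaplacian

open Finset Matrix
open scoped BigOperators ComplexConjugate
open Summit.QuantumFields.BalabanUV.Beta.TentQuasiReconstruction1D
open Literature.MathematicalPhysics.QuantumFieldTheory.Balaban1983to89.B5Prop11Lower (nsq nsq_nonneg star_dotProduct_self)

noncomputable section

variable {ν m n : ℕ} [NeZero m]

/-- The torus: ν coordinates, each in ℤ/m × Fin n. [folklore] -/
abbrev Site (ν m n : ℕ) : Type := Fin ν → ZMod m × Fin n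

/-- The blocks: ν block labels. [folklore] -/
abbrev Blk (ν m : ℕ) : Type := Fin ν → ZMod m

/-! ## §2  The operator A = μ·1 + Σ_i D_iᴴD_i -/

/-- The shift along axis i: `(S_i g)(x) = g(x with x_i ↦ succ x_i)`. [folklore] -/
def shiftMat (i : Fin ν) : Matrix (Site ν m n) (Site ν m n) ℂ :=
  fun x x' => if x' = Function.update x i (succ (x i)) then 1 else 0

/-- `(S_i g)(x) = g(update x i (succ (x i)))`. [folklore] -/
theorem shiftMat_mulVec (i : Fin ν) (g : Site ν m n → ℂ) (x : Site ν m n) :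
    (shiftMat i *ᵥ g) x = g (Function.update x i (succ (x i))) := by
  simp only [Matrix.mulVec, dotProduct, shiftMat, ite_mul, one_mul, zero_mul, Finset.sum_ite_eq', Finset.mem_univ,
    if_true]

/-- The forward difference along axis i: D_i = S_i − 1. [folklore] -/
def dMat (i : Fin ν) : Matrix (Site ν m n) (Site ν m n) ℂ := shiftMat i - 1

/-- `(D_i g)(x) = g(x⁺ᵢ) − g(x)`. [folklore] -/
theorem dMat_mulVec (i : Fin ν) (g : Site ν m n → ℂ) (x : Site ν m n) :
    (dMat i *ᵥ g) x = g (Function.update x i (succ (x i))) - g x := by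
  rw [dMat, Matrix.sub_mulVec, Pi.sub_apply, shiftMat_mulVec, Matrix.one_mulVec]

/-- **The operator A = μ·1 + Σ_i D_iᴴD_i** (free lattice Laplacian on the torus plus a mass). [folklore] -/
def lapA (ν m n : ℕ) [NeZero m] (μ : ℝ) : Matrix (Site ν m n) (Site ν m n) ℂ :=
  ((μ : ℝ) : ℂ) • (1 : Matrix (Site ν m n) (Site ν m n) ℂ) + ∑ i, (dMat i)ᴴ * dMat i

/-- A is Hermitian. [folklore] -/
theorem lapA_isHermitian (μ : ℝ) : (lapA ν m n μ).IsHermitian := by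
  unfold Matrix.IsHermitian lapA
  rw [Matrix.conjTranspose_add, Matrix.conjTranspose_smul, Matrix.conjTranspose_one, Matrix.conjTranspose_sum]
  congr 1
  · rw [Complex.star_def, Complex.conj_ofReal]
  · exact Finset.sum_congr rfl fun i _ => by rw [Matrix.conjTranspose_mul, Matrix.conjTranspose_conjTranspose]

/-- **The form of A**: `g*Ag = μ‖g‖² + Σ_i ‖D_ig‖²`. [folklore] -/
theorem form_lapA (μ : ℝ) (g : Site ν m n → ℂ) :
    star g ⬝ᵥ (lapA ν m n μ *ᵥ g) = ((μ * nsq g + ∑ i, nsq (dMat i *ᵥ g) : ℝ) : ℂ) := by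
  have hD : ∀ i : Fin ν, star g ⬝ᵥ (((dMat (m := m) (n := n) i)ᴴ * dMat i) *ᵥ g) = ((nsq (dMat i *ᵥ g) : ℝ) : ℂ) :=
    fun i => by
      rw [← Matrix.mulVec_mulVec, Matrix.dotProduct_mulVec, Matrix.vecMul_conjTranspose, star_star, star_dotProduct_self]
  rw [lapA, Matrix.add_mulVec, Matrix.smul_mulVec, Matrix.one_mulVec, Matrix.sum_mulVec, dotProduct_add,
    dotProduct_smul, dotProduct_sum, star_dotProduct_self]
  simp only [hD, smul_eq_mul]
  push_cast
  ring

/-- The real part of the form is `μ‖g‖² + Σ_i ‖D_ig‖²`. [folklore] -/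
theorem re_form_lapA (μ : ℝ) (g : Site ν m n → ℂ) :
    (star g ⬝ᵥ (lapA ν m n μ *ᵥ g)).re = μ * nsq g + ∑ i, nsq (dMat i *ᵥ g) := by
  rw [form_lapA, Complex.ofReal_re]

/-- A is `Re`-positive semidefinite for μ ≥ 0. [folklore] -/
theorem lapA_re_nonneg {μ : ℝ} (hμ : 0 ≤ μ) (g : Site ν m n → ℂ) : 0 ≤ (star g ⬝ᵥ (lapA ν m n μ *ᵥ g)).re := by
  rw [re_form_lapA]
  exact add_nonneg (mul_nonneg hμ (nsq_nonneg g)) (Finset.sum_nonneg fun i _ => nsq_nonneg _)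

omit [NeZero m] in
/-- `nsq g = 0 ⇒ g = 0`. [folklore] -/
theorem eq_zero_of_nsq_eq_zero {X : Type*} [Fintype X] (g : X → ℂ) (h : nsq g = 0) : g = 0 := by
  funext x
  have hx : ‖g x‖ ^ 2 = 0 := by
    have hle : ‖g x‖ ^ 2 ≤ nsq g := Finset.single_le_sum (f := fun x => ‖g x‖ ^ 2) (fun y _ => sq_nonneg _) (mem_univ x)
    rw [h] at hle
    exact le_antisymm hle (sq_nonneg _)
  exact norm_eq_zero.mp (pow_eq_zero_iff two_ne_zero |>.mp hx)

/-- **A is a unit for μ > 0** (μ‖v‖² ≤ Re v*Av = 0 forces v = 0). [folklore] -/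
theorem lapA_isUnit {μ : ℝ} (hμ : 0 < μ) : IsUnit (lapA ν m n μ) := by
  rw [← Matrix.mulVec_injective_iff_isUnit]
  intro v v' h
  have h0 : lapA ν m n μ *ᵥ (v - v') = 0 := by rw [Matrix.mulVec_sub, h, sub_self]
  have hform := re_form_lapA μ (v - v')
  rw [h0, dotProduct_zero, Complex.zero_re] at hform
  have hn : nsq (v - v') = 0 := by
    have h1 : 0 ≤ ∑ i, nsq (dMat (m := m) (n := n) i *ᵥ (v - v')) := Finset.sum_nonneg fun i _ => nsq_nonneg _
    have h2 := nsq_nonneg (v - v')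
    nlinarith
  exact sub_eq_zero.mp (eq_zero_of_nsq_eq_zero _ hn)

end

end Summit.QuantumFields.BalabanUV.Beta.TentQuasiReconstructionLaplacian
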